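import Summits.Parity.GeneralizedHardyLittlewood.Theorems.LiouvilleShiftedTablesTypeI2DilatedURB3
import Summits.Parity.GeneralizedHardyLittlewood.Theorems.LiouvilleShiftedTablesTypeI2DilatedURB4

/-!
# The `𝔲_R` terms of the assembly (`stub_uRBound`), file 6: Type I reduction to smooth tuples

Route `LiouvilleShiftedTables` (Parity / GeneralizedHardyLittlewood), crux `TypeI2Dilated` (stmt-Parity-14272), line
`peel-to-drappeau`, registered stub `stub_uRBound : URBound`; continuation of `…URB1`–`…URB4`.

In the TYPE I case of Drappeau's trichotomy a box piece factors as `F_{j,κ} = A ⋆ Z`, where `A = ∏_{i ∉ T} slot_i` collects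
the small slots (supported on `ν ≤ N_A = 2^8 x^{1/50}`, values `≤ τ^8`) and `Z = ∏_{i ∈ T} slot_i` the `#T = k+1 ≤ 3`
LARGE slots, all of them `ζ`-slots (`slot_i = 1_{(V_i, 2V_i]}`).  Then, deterministically,

`NS(A ⋆ Z) ≤ ∑_{q ≤ x^ρ} ∑_{r ≤ R} ∑_{ν ≤ N_A} |A(ν)| · B(q, r, ν)`,
`B(q, r, ν) = ∑_{s ∈ sRange} ‖∑_{n⃗ : nₜ ∼ Vₜ} [ν ∏ nₜ ∈ classFilter] 𝔲_{x^{40ρ}}(ν ∏ nₜ c̄; s)‖`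

(`normSum_mul_tuple_le`, by the multilinear expansion `TupleSums.sum_prod_apply_mul_eq_sum_piFinset` with the factors
`A, slot_{t₀}, …, slot_{t_k}`), and `normSum_hbBox_typeI_le` specialises this to the box pieces (re-indexing `T` by
`Fin (k+1)` through `Finset.orderEmbOfFin`).  The quantity `B(q, r, ν)` is the left side of the Literature theorem
`DrappeauTypeI.typeI_core` (next file).
[this line: Lines/peel-to-drappeau.md; cite: Drappeau2017, §6.2]
-/

noncomputable section

namespace Summit.Parity.GeneralizedHardyLittlewood.Cruxes.TypeI2Dilated.PeelToDrappeau

open Finset Fintype Real Filter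
open scoped ArithmeticFunction.sigma Classical
open Literature.NumberTheory.Sieve Literature.NumberTheory.Sieve.Drappeau2017

/-! ### The `ζ`-slots -/

/-- A `ζ`-slot (`j < i`) is the indicator of its dyadic box: `slot_i(n) = 1` for `n ∼ V_i`. [this line] -/
theorem hbSlot_apply_of_mem {x : ℝ} (hx : 0 < x) (ρ : ℝ) {j : ℕ} (κ : Fin (2 * j) → ℕ) {i : Fin (2 * j)}
    (hi : j < (i : ℕ)) {n : ℕ} (hn : n ∈ BFI.dyadic (boxScale x (κ i))) : hbSlot x ρ j κ i n = 1 := by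
  have hV := boxScale_pos hx (κ i)
  obtain ⟨h1, h2⟩ := (BFI.mem_dyadic hV.le).1 hn
  have hn0 : 0 < n := by exact_mod_cast hV.trans h1
  unfold hbSlot
  rw [BFI.boxRestrict_apply, if_pos, HeathBrownLiouville.hbFactor_zeta_apply hi hn0.ne']
  refine ⟨hn0, h1, ?_⟩
  rw [BFI.boxHigh_eq_mul_boxLow (by norm_num) (κ i)]
  rw [boxScale] at h2
  linarith

/-! ### The multilinear expansion with one free factor -/

/-- **Expansion of `A ⋆ ∏ₜ fₜ` over the class filter** when the `fₜ` are indicators of dyadic boxes `(Wₜ, 2Wₜ]` and `A`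
is supported on `[1, N_A]`:
`∑_{m ∈ CF} (A ⋆ ∏ fₜ)(m) u(m) = ∑_{ν ≤ N_A} A(ν) ∑_{n⃗ : nₜ ∼ Wₜ} [ν ∏ nₜ ∈ CF] u(ν ∏ nₜ)`. [this line] -/
theorem mul_tuple_classFilter_expand {k : ℕ} (A : ArithmeticFunction ℝ) (f : Fin (k + 1) → ArithmeticFunction ℝ)
    (W : Fin (k + 1) → ℝ) (hf0 : ∀ t n, f t n ≠ 0 → n ∈ BFI.dyadic (W t))
    (hf1 : ∀ t, ∀ n ∈ BFI.dyadic (W t), f t n = 1) {NA : ℝ} (hA : ∀ ν, A ν ≠ 0 → (ν : ℝ) ≤ NA)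
    (c : ℤ) (q w r : ℕ) (Y : ℝ) (u : ℕ → ℂ) :
    ∑ m ∈ classFilter c q w r Y, (((A * ∏ t, f t) m : ℝ) : ℂ) * u m =
      ∑ ν ∈ Icc 1 ⌊NA⌋₊, ((A ν : ℝ) : ℂ) * ∑ n ∈ piFinset (fun t => BFI.dyadic (W t)),
        (if ν * ∏ t, n t ∈ classFilter c q w r Y then u (ν * ∏ t, n t) else 0) := by
  set g : Fin (k + 1 + 1) → ArithmeticFunction ℝ := Fin.cons A f with hg
  set D : Fin (k + 1 + 1) → Finset ℕ := Fin.cons (Icc 1 ⌊NA⌋₊) (fun t => BFI.dyadic (W t)) with hD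
  have hgD : ∀ i m, g i m ≠ 0 → m ∈ D i := by
    intro i m hm
    refine Fin.cases ?_ (fun t => ?_) i hm
    · intro h
      simp only [hg, hD, Fin.cons_zero] at h ⊢
      have hm0 : m ≠ 0 := fun h0 => h (by rw [h0, ArithmeticFunction.map_zero])
      exact Finset.mem_Icc.2 ⟨Nat.one_le_iff_ne_zero.2 hm0, Nat.le_floor (hA m h)⟩
    · intro h
      simp only [hg, hD, Fin.cons_succ] at h ⊢
      exact hf0 t m h
  have key := TupleSums.sum_prod_apply_mul_eq_sum_piFinset _ g D hgD (classFilter c q w r Y)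
    (zero_notMem_classFilter c q w r Y) u
  have hgprod : (∏ i, g i) = A * ∏ t, f t := by
    rw [Fin.prod_univ_succ]
    simp only [hg, Fin.cons_zero, Fin.cons_succ]
  rw [hgprod] at key
  rw [key, TupleSums.sum_piFinset_succ D]
  have hD0 : D 0 = Icc 1 ⌊NA⌋₊ := by simp only [hD, Fin.cons_zero]
  have hDt : Fin.tail D = fun t => BFI.dyadic (W t) := by simp only [hD, Fin.tail_cons]
  rw [hD0, hDt]
  refine Finset.sum_congr rfl fun ν _ => ?_
  rw [Finset.mul_sum]
  refine Finset.sum_congr rfl fun n hn => ?_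
  have hprodn : (∏ i, (Fin.cons ν n : Fin (k + 1 + 1) → ℕ) i) = ν * ∏ t, n t := Fin.prod_cons ν n
  have hprodg : (∏ i, (g i ((Fin.cons ν n : Fin (k + 1 + 1) → ℕ) i) : ℂ)) = ((A ν : ℝ) : ℂ) := by
    rw [Fin.prod_univ_succ]
    simp only [hg, Fin.cons_zero, Fin.cons_succ]
    rw [Finset.prod_eq_one fun t _ => ?_, mul_one]
    rw [hf1 t (n t) (Fintype.mem_piFinset.1 hn t), Complex.ofReal_one]
  rw [hprodn, hprodg]
  split_ifs <;> simp

/-- **`NS(A ⋆ Z)` reduced to smooth tuples** (see the module docstring). [this line] -/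
theorem normSum_mul_tuple_le {k : ℕ} (A : ArithmeticFunction ℝ) (f : Fin (k + 1) → ArithmeticFunction ℝ)
    (W : Fin (k + 1) → ℝ) (hf0 : ∀ t n, f t n ≠ 0 → n ∈ BFI.dyadic (W t))
    (hf1 : ∀ t, ∀ n ∈ BFI.dyadic (W t), f t n = 1) {NA : ℝ} (hA : ∀ ν, A ν ≠ 0 → (ν : ℝ) ≤ NA)
    (c : ℤ) (w P : ℕ) (x ρ Y R Slo : ℝ) :
    normSum c w P x ρ Y R Slo (fun m => (A * ∏ t, f t) m) ≤
      ∑ q ∈ Icc 1 ⌊x ^ ρ⌋₊, ∑ r ∈ Icc 1 ⌊R⌋₊, ∑ ν ∈ Icc 1 ⌊NA⌋₊, |A ν| *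
        ∑ s ∈ sRange c q (r * P) Slo (2 * Slo), ‖∑ n ∈ piFinset (fun t => BFI.dyadic (W t)),
          (if ν * ∏ t, n t ∈ classFilter c q w (r * P) Y then
            uR (x ^ (40 * ρ)) s (((ν * ∏ t, n t : ℕ) : ZMod s) * ((c : ZMod s))⁻¹) else 0)‖ := by
  unfold normSum
  refine Finset.sum_le_sum fun q _ => Finset.sum_le_sum fun r _ => ?_
  have hexp : ∀ s ∈ sRange c q (r * P) Slo (2 * Slo), ∑ m ∈ classFilter c q w (r * P) Y,
      (((A * ∏ t, f t) m : ℝ) : ℂ) * uR (x ^ (40 * ρ)) s ((m : ZMod s) * ((c : ZMod s))⁻¹) =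
      ∑ ν ∈ Icc 1 ⌊NA⌋₊, ((A ν : ℝ) : ℂ) * ∑ n ∈ piFinset (fun t => BFI.dyadic (W t)),
        (if ν * ∏ t, n t ∈ classFilter c q w (r * P) Y then
          uR (x ^ (40 * ρ)) s (((ν * ∏ t, n t : ℕ) : ZMod s) * ((c : ZMod s))⁻¹) else 0) :=
    fun s _ => mul_tuple_classFilter_expand A f W hf0 hf1 hA c q w (r * P) Y _
  rw [Finset.sum_congr rfl hexp, Finset.sum_comm]
  refine (norm_sum_le _ _).trans (Finset.sum_le_sum fun ν _ => ?_)
  rw [← Finset.mul_sum, norm_mul, Complex.norm_real, Real.norm_eq_abs]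
  exact mul_le_mul_of_nonneg_left (norm_sum_le _ _) (abs_nonneg _)

/-! ### The box pieces in Type I form -/

/-- Re-indexing the large slots by `Fin (k+1)`: `∏_{i ∈ T} slot_i = ∏_{t} slot_{e t}`, `e = T.orderEmbOfFin`. [folklore] -/
theorem prod_eq_prod_orderEmbOfFin {ι M : Type*} [LinearOrder ι] [CommMonoid M] (T : Finset ι) {n : ℕ}
    (h : T.card = n) (F : ι → M) : ∏ i ∈ T, F i = ∏ t : Fin n, F (T.orderEmbOfFin h t) := by
  rw [← Finset.prod_coe_sort]
  symm
  refine Fintype.prod_equiv (T.orderIsoOfFin h).toEquiv _ _ fun t => ?_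
  simp only [RelIso.coe_fn_toEquiv, Finset.coe_orderIsoOfFin_apply]

/-- **The box pieces in Type I form.**  Let `T` be a set of `k + 1` slots of `F_{j,κ}`, all `ζ`-slots (`j < i`), and let
`N_A ≥ 1` bound the support of the complementary factor `A = ∏_{i ∉ T} slot_i` (`∏_{i∉T} 2V_i ≤ N_A`).  Then
`NS(F_{j,κ}) ≤ ∑_{q,r} ∑_{ν ≤ N_A} |A(ν)| B(q, r, ν)` with the scales `Wₜ = V_{e t}`, `e = T.orderEmbOfFin`. [this line] -/
theorem normSum_hbBox_typeI_le {x : ℝ} (hx : 0 < x) (ρ : ℝ) {j : ℕ} (κ : Fin (2 * j) → ℕ)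
    (T : Finset (Fin (2 * j))) {k : ℕ} (hTk : T.card = k + 1) (hTζ : ∀ i ∈ T, j < (i : ℕ))
    {NA : ℝ} (hNA1 : 1 ≤ NA) (hNA : ∏ i ∈ Tᶜ, (2 * boxScale x (κ i)) ≤ NA)
    (c : ℤ) (w P : ℕ) (Y R Slo : ℝ) :
    normSum c w P x ρ Y R Slo (fun m => hbBox x ρ j κ m) ≤
      ∑ q ∈ Icc 1 ⌊x ^ ρ⌋₊, ∑ r ∈ Icc 1 ⌊R⌋₊, ∑ ν ∈ Icc 1 ⌊NA⌋₊, |(∏ i ∈ Tᶜ, hbSlot x ρ j κ i) ν| *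
        ∑ s ∈ sRange c q (r * P) Slo (2 * Slo),
          ‖∑ n ∈ piFinset (fun t : Fin (k + 1) => BFI.dyadic (boxScale x (κ (T.orderEmbOfFin hTk t)))),
            (if ν * ∏ t, n t ∈ classFilter c q w (r * P) Y then
              uR (x ^ (40 * ρ)) s (((ν * ∏ t, n t : ℕ) : ZMod s) * ((c : ZMod s))⁻¹) else 0)‖ := by
  set e := T.orderEmbOfFin hTk with he
  set A : ArithmeticFunction ℝ := ∏ i ∈ Tᶜ, hbSlot x ρ j κ i with hA
  set f : Fin (k + 1) → ArithmeticFunction ℝ := fun t => hbSlot x ρ j κ (e t) with hf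
  set W : Fin (k + 1) → ℝ := fun t => boxScale x (κ (e t)) with hW
  have heT : ∀ t, e t ∈ T := fun t => Finset.orderEmbOfFin_mem T hTk t
  have hdecomp : hbBox x ρ j κ = A * ∏ t, f t := by
    rw [hbBox, ← Finset.prod_compl_mul_prod T, prod_eq_prod_orderEmbOfFin T hTk]
  have hf0 : ∀ t n, f t n ≠ 0 → n ∈ BFI.dyadic (W t) := fun t n hn => (hbSlot_ne_zero hx hn).1
  have hf1 : ∀ t, ∀ n ∈ BFI.dyadic (W t), f t n = 1 := fun t n hn =>
    hbSlot_apply_of_mem hx ρ κ (hTζ _ (heT t)) hn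
  have hAsupp : ∀ ν, A ν ≠ 0 → (ν : ℝ) ≤ NA := by
    intro ν hν
    rcases (Tᶜ).eq_empty_or_nonempty with hemp | hne
    · rw [hA, hemp, Finset.prod_empty, ArithmeticFunction.one_apply] at hν
      have : ν = 1 := by by_contra h; exact hν (if_neg h)
      rw [this, Nat.cast_one]; exact hNA1
    · exact (prod_hbSlot_ne_zero_bounds hx ρ κ hne hν).2.trans hNA
  rw [show (fun m => hbBox x ρ j κ m) = (fun m => (A * ∏ t, f t) m) from funext fun m => by rw [hdecomp]]
  exact normSum_mul_tuple_le A f W hf0 hf1 hAsupp c w P x ρ Y R Slo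

/-- Landing anchor of the `𝔲_R`-bound chain, file 6; registered stub `urbChain6_anchor` of the crux item (the
mathematical content of this file is `normSum_hbBox_typeI_le`). -/
theorem urbChain6_anchor : True := trivial

end Summit.Parity.GeneralizedHardyLittlewood.Cruxes.TypeI2Dilated.PeelToDrappeau

end
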